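import Summits.AnomalousDissipation.AnomalousDissipation.Theses.TaylorCertificates
import Literature.Barriers.NavierStokesRegularity.DyadicCascadeRegularity

/-!
# Sketch — crux-ideate stmt-AnomalousDissipation-14030 (`TaylorCertificates.KolmogorovFloor`), round 1, ideator 1

First lemmas of the two idea cards, typed over existing declarations (they elaborate; one is proved):

* card `available-storage-game`: `FloorAt`, `IsBandLimitedGeneratorCurve` (= trajectories of the
  tail-relaxed Galerkin-`N` inclusion, typed through the cylindrical chain rule), `quietExcess`,
  FIRST LEMMA `StorageOfFloor` (PROVED: a floor certificate is a Willems storage function),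
  the transfer statement `BoundedQuietExcess` (C⁺) and the transfer stub `WillemsSmoothingTransfer`,
  plus `boundedQuietExcess_of_kolmogorovFloor_shape` (KolmogorovFloor-shape ⇒ C⁺ given a bound on `|Φ₁|`).
* card `dyadic-shadow-certifiability`: FIRST LEMMA / template target `DyadicKolmogorovFloor`
  over the tree's `cheskidovRHS` (Cheskidov 2008 (3.1), `α = 1`).
-/

noncomputable section

open MeasureTheory intervalIntegral Set

namespace Summit.AnomalousDissipation.AnomalousDissipation.Cruxes.KolmogorovFloor.Ideate1

open Literature.Analysis.FunctionSpaces Literature.Analysis.FluidPDE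

local notation "𝕋³" => UnitAddTorus (Fin 3)
local notation "E³" => EuclideanSpace ℝ (Fin 3)
local notation "HH" => Literature.Analysis.FunctionSpaces.Torus.energySpace (Fin 3)
local notation "L2T" => MeasureTheory.Lp (EuclideanSpace ℝ (Fin 3)) 2
  (MeasureTheory.volume : MeasureTheory.Measure (UnitAddTorus (Fin 3)))

/-- The state `u ∈ H` as a function on the torus. -/
def toFun (u : HH) : 𝕋³ → E³ := ((u : L2T) : 𝕋³ → E³)

/-- Viscous dissipation `D(u) = ν‖∇u‖²` (spectral, junk `0` at infinite enstrophy). -/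
def dissip (ν : ℝ) (u : HH) : ℝ := ν * (Torus.eGradNormSq (toFun u)).toReal

/-- The pointwise FLOOR inequality of the crux at `(ν, Φ₁, θ₁)` on the ball `‖u‖² ≤ ρ`
(verbatim the inner clause of `KolmogorovFloor` / `FloorCertificate` / `FloorTransfer`). -/
def FloorAt (ν ε₀ ρ θ₁ : ℝ) (f : 𝕋³ → E³) (Φ₁ : Torus.CylindricalTest (Fin 3)) : Prop :=
  ∀ u : HH, Torus.eGradNormSq (toFun u) ≠ ⊤ → ‖u‖ ^ 2 ≤ ρ →
    ε₀ ≤ dissip ν u + Torus.nsGeneratorPairing ν f u (Φ₁.grad u) +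
      2 * θ₁ * (Torus.pairing (u : L2T) f - dissip ν u)

/-- BAND-LIMITED GENERATOR CURVES: curves `U : ℝ → H` along which every cylindrical functional with
test fields of degree `≤ N` obeys the chain rule with the Navier–Stokes generator. Testing with the
coordinate functionals shows: the resolved part `P_N U` solves the Galerkin-`N` Navier–Stokes system
driven by the resolved stress of the UNRESOLVED part of `U`, which is otherwise free — these are exactly
the trajectories of the tail-relaxed (adversarial-subgrid) Galerkin inclusion of the card. Every `H`-lift
of a Leray–Hopf solution is one (`IsGlobalLerayHopf.cylindrical_eval_sub_eq_integral`). -/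
def IsBandLimitedGeneratorCurve (ν : ℝ) (f : 𝕋³ → E³) (N : ℕ) (U : ℝ → HH) : Prop :=
  ∀ Φ : Torus.CylindricalTest (Fin 3), (∀ i, Torus.fourierTruncate N (Φ.g i) = Φ.g i) →
    ∀ s t : ℝ, s ≤ t →
      IntervalIntegrable (fun τ => Torus.nsGeneratorPairing ν f (U τ) (Φ.grad (U τ))) volume s t ∧
      Φ.eval (U t) - Φ.eval (U s) = ∫ τ in s..t, Torus.nsGeneratorPairing ν f (U τ) (Φ.grad (U τ))

/-- The QUIET EXCESS of a curve on `[s,t]` for floor level `ε₀` and energy weight `θ ≥ 0`: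
`∫ₛᵗ (ε₀ − (1+2θ)ν‖∇U‖² + 2θ(U,f)) dτ` — minus Willems' supply integral for the supply rate
`(1+2θ)D − 2θ(u,f) − ε₀`. -/
def quietExcess (ν ε₀ θ : ℝ) (f : 𝕋³ → E³) (U : ℝ → HH) (s t : ℝ) : ℝ :=
  ∫ τ in s..t, (ε₀ - (1 + 2 * θ) * dissip ν (U τ) + 2 * θ * Torus.pairing (U τ : L2T) f)

/-- FIRST LEMMA (card `available-storage-game`, weak direction; Willems 1972 Thm 1 "⇒"): a floor
certificate with band-limited test fields is a STORAGE FUNCTION of the tail-relaxed Galerkin inclusion —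
along every band-limited generator curve staying in the ball, the quiet excess is bounded by the
oscillation of `Φ₁`. -/
def StorageOfFloor : Prop :=
  ∀ (ν ε₀ ρ θ₁ : ℝ) (f : 𝕋³ → E³) (N : ℕ) (Φ₁ : Torus.CylindricalTest (Fin 3)) (U : ℝ → HH) (s t : ℝ),
    0 < ν → θ₁ ≤ 0 → (∀ i, Torus.fourierTruncate N (Φ₁.g i) = Φ₁.g i) →
    FloorAt ν ε₀ ρ θ₁ f Φ₁ → IsBandLimitedGeneratorCurve ν f N U → s ≤ t →
    (∀ τ ∈ Icc s t, Torus.eGradNormSq (toFun (U τ)) ≠ ⊤ ∧ ‖U τ‖ ^ 2 ≤ ρ) →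
    IntervalIntegrable (fun τ => dissip ν (U τ)) volume s t →
    IntervalIntegrable (fun τ => Torus.pairing (U τ : L2T) f) volume s t →
    quietExcess ν ε₀ (-θ₁) f U s t ≤ Φ₁.eval (U t) - Φ₁.eval (U s)

theorem storageOfFloor_holds : StorageOfFloor := by
  intro ν ε₀ ρ θ₁ f N Φ₁ U s t _hν _hθ hband hfloor hcurve hst hball hD hP
  obtain ⟨hG, heq⟩ := hcurve Φ₁ hband s t hst
  rw [quietExcess, heq]
  refine intervalIntegral.integral_mono_on hst ?_ hG ?_
  · exact (intervalIntegrable_const.sub (hD.const_mul _)).add (hP.const_mul _)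
  · intro τ hτ
    have h := hfloor (U τ) (hball τ hτ).1 (hball τ hτ).2
    linarith

/-- C⁺ of the card (TRANSFER): BOUNDED QUIET EXCESS — Willems' AVAILABLE STORAGE of the tail-relaxed
Kolmogorov–Galerkin inclusion of `f` (resolution `N ≤ Cν^{-3/4}`, supply rate `(1+2θ)D − 2θ(u,f) − ε₀`)
is bounded on the Leray ball, with `ε₀, C, Θ` independent of `ν` (the bound `K` may depend on `ν`). -/
def BoundedQuietExcess : Prop :=
  ∃ f : 𝕋³ → E³, Torus.IsSmooth f ∧ Torus.IsDivFree f ∧ Torus.HasZeroMean f ∧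
    ∃ (ε₀ C Θ ν₀ : ℝ), 0 < ε₀ ∧ 0 < ν₀ ∧ ∀ ν : ℝ, 0 < ν → ν < ν₀ →
      ∃ (N : ℕ) (θ K : ℝ), (N : ℝ) ≤ C * ν ^ (-(3 / 4 : ℝ)) ∧ 0 ≤ θ ∧ θ ≤ Θ ∧
        ∀ (U : ℝ → HH) (s t : ℝ), s ≤ t → IsBandLimitedGeneratorCurve ν f N U →
          (∀ τ ∈ Icc s t, Torus.eGradNormSq (toFun (U τ)) ≠ ⊤ ∧
            ‖U τ‖ ^ 2 ≤ 16 * (∫ x, ‖f x‖ ^ 2) / ν ^ 2) →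
          IntervalIntegrable (fun τ => dissip ν (U τ)) volume s t →
          IntervalIntegrable (fun τ => Torus.pairing (U τ : L2T) f) volume s t →
          quietExcess ν ε₀ θ f U s t ≤ K

/-- The TRANSFER STUB of the line: Willems 1972 (available storage finite ⇒ it is a storage function,
by dynamic programming) + smooth converse-Lyapunov technology for differential inclusions
(Clarke–Ledyaev–Stern 1998 / Teel–Praly 2000: inf-convolution + mollification, spending an
`ε₀`-margin) inside the cylindrical class (the available storage is a function of `P_N u` only). -/
def WillemsSmoothingTransfer : Prop :=
  BoundedQuietExcess → Theses.TaylorCertificates.KolmogorovFloor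

/-- Sanity (the easy direction, modulo a bound `B` on `|Φ₁|`, which `CylindricalTest` always has:
compactly supported continuous profile): the KolmogorovFloor shape at one `ν` gives the C⁺ clause at
that `ν` with `K = 2B`. -/
theorem quietExcess_le_of_floor {ν ε₀ ρ θ₁ B : ℝ} {f : 𝕋³ → E³} {N : ℕ}
    {Φ₁ : Torus.CylindricalTest (Fin 3)} (hν : 0 < ν) (hθ : θ₁ ≤ 0)
    (hband : ∀ i, Torus.fourierTruncate N (Φ₁.g i) = Φ₁.g i) (hfloor : FloorAt ν ε₀ ρ θ₁ f Φ₁)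
    (hB : ∀ u, |Φ₁.eval u| ≤ B) {U : ℝ → HH} {s t : ℝ} (hst : s ≤ t)
    (hcurve : IsBandLimitedGeneratorCurve ν f N U)
    (hball : ∀ τ ∈ Icc s t, Torus.eGradNormSq (toFun (U τ)) ≠ ⊤ ∧ ‖U τ‖ ^ 2 ≤ ρ)
    (hD : IntervalIntegrable (fun τ => dissip ν (U τ)) volume s t)
    (hP : IntervalIntegrable (fun τ => Torus.pairing (U τ : L2T) f) volume s t) :
    quietExcess ν ε₀ (-θ₁) f U s t ≤ 2 * B := by
  have h := storageOfFloor_holds ν ε₀ ρ θ₁ f N Φ₁ U s t hν hθ hband hfloor hcurve hst hball hD hP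
  have h1 := hB (U t)
  have h2 := hB (U s)
  have h3 : Φ₁.eval (U t) - Φ₁.eval (U s) ≤ 2 * B := by
    cases abs_le.mp h1; cases abs_le.mp h2; linarith
  linarith

/-! ### Card `dyadic-shadow-certifiability`: the dyadic Kolmogorov floor (template theorem) -/


/-- FIRST LEMMA / TARGET of card `dyadic-shadow-certifiability`: the dyadic shadow of `KolmogorovFloor`.
Cheskidov's model (3.1) with `α = 1` (`uₙ' = −νλ²ⁿuₙ + λⁿu²ₙ₋₁ − λⁿ⁺¹uₙuₙ₊₁ + gₙ`, `u₀ = 0`), force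
`g = g₁e₁`, on the positive cone: a ν-UNIFORM band-limited (modes `≤ J`, `λ^J ≤ Cν^{-3/4}`) `C¹`
bounded-profile certificate with energy weight `θ ∈ [0,Θ]` and PRICED TAIL (the state `u` carries all
modes; the certificate sees `u₀,…,u_J`; `u_{J+1}` enters through `cheskidovRHS … J`):
`ε₀ ≤ (1+2θ)·ν Σₙ λ²ⁿuₙ² − 2θ g₁u₁ + Σ_{n ≤ J} ∂ₙφ(u_{≤J}) · RHSₙ(u)` at every finite-enstrophy
state of the cone with energy `≤ 16g₁²/ν²`. Conjectured TRUE (M/L): the first theorem-sized instance of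
the certificate species at Kolmogorov resolution; its explicit `φ` is the template. -/
def DyadicKolmogorovFloor (lam : ℝ) : Prop :=
  ∃ (g₁ ε₀ C Θ ν₀ : ℝ), 0 < g₁ ∧ 0 < ε₀ ∧ 0 < ν₀ ∧ ∀ ν : ℝ, 0 < ν → ν < ν₀ →
    ∃ (J : ℕ) (φ : EuclideanSpace ℝ (Fin (J + 1)) → ℝ) (θ : ℝ),
      lam ^ J ≤ C * ν ^ (-(3 / 4 : ℝ)) ∧ ContDiff ℝ 1 φ ∧ (∃ B : ℝ, ∀ y, |φ y| ≤ B) ∧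
      0 ≤ θ ∧ θ ≤ Θ ∧
      ∀ u : ℕ → ℝ, u 0 = 0 → (∀ n, 0 ≤ u n) → Summable (fun n => lam ^ (2 * n) * u n ^ 2) →
        (∑' n, u n ^ 2) ≤ 16 * g₁ ^ 2 / ν ^ 2 →
        let g : ℕ → ℝ := fun n => if n = 1 then g₁ else 0
        let y : EuclideanSpace ℝ (Fin (J + 1)) := WithLp.toLp 2 fun i => u i
        ε₀ ≤ (1 + 2 * θ) * (ν * ∑' n, lam ^ (2 * n) * u n ^ 2) - 2 * θ * (g₁ * u 1) +
          ∑ i : Fin (J + 1), (fderiv ℝ φ y (EuclideanSpace.single i 1)) *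
            Literature.Barriers.NavierStokesRegularity.Dyadic.cheskidovRHS lam ν 1 g u i

/-- The signed (full phase space) variant: same, without the cone hypothesis `0 ≤ uₙ` (harder; the
NS-faithful domain is the whole ball). -/
def DyadicKolmogorovFloorSigned (lam : ℝ) : Prop :=
  ∃ (g₁ ε₀ C Θ ν₀ : ℝ), 0 < g₁ ∧ 0 < ε₀ ∧ 0 < ν₀ ∧ ∀ ν : ℝ, 0 < ν → ν < ν₀ →
    ∃ (J : ℕ) (φ : EuclideanSpace ℝ (Fin (J + 1)) → ℝ) (θ : ℝ),
      lam ^ J ≤ C * ν ^ (-(3 / 4 : ℝ)) ∧ ContDiff ℝ 1 φ ∧ (∃ B : ℝ, ∀ y, |φ y| ≤ B) ∧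
      0 ≤ θ ∧ θ ≤ Θ ∧
      ∀ u : ℕ → ℝ, u 0 = 0 → Summable (fun n => lam ^ (2 * n) * u n ^ 2) →
        (∑' n, u n ^ 2) ≤ 16 * g₁ ^ 2 / ν ^ 2 →
        let g : ℕ → ℝ := fun n => if n = 1 then g₁ else 0
        let y : EuclideanSpace ℝ (Fin (J + 1)) := WithLp.toLp 2 fun i => u i
        ε₀ ≤ (1 + 2 * θ) * (ν * ∑' n, lam ^ (2 * n) * u n ^ 2) - 2 * θ * (g₁ * u 1) +
          ∑ i : Fin (J + 1), (fderiv ℝ φ y (EuclideanSpace.single i 1)) *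
            Literature.Barriers.NavierStokesRegularity.Dyadic.cheskidovRHS lam ν 1 g u i

theorem dyadicKolmogorovFloor_of_signed (lam : ℝ) :
    DyadicKolmogorovFloorSigned lam → DyadicKolmogorovFloor lam := by
  rintro ⟨g₁, ε₀, C, Θ, ν₀, hg, hε, hν₀, h⟩
  refine ⟨g₁, ε₀, C, Θ, ν₀, hg, hε, hν₀, fun ν hν hνν => ?_⟩
  obtain ⟨J, φ, θ, hJ, hφ, hB, hθ0, hθ, hall⟩ := h ν hν hνν
  exact ⟨J, φ, θ, hJ, hφ, hB, hθ0, hθ, fun u h0 _ hs he => hall u h0 hs he⟩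


/-- THE EXPLICIT LINEAR K41 LADDER (card `k41-ladder-dirichlet-form`): `V_J(u) = c Σ_{1≤n≤J} λ^{-n/3} uₙ`
works as a ν-uniform Kolmogorov-resolution floor certificate with priced tail for Cheskidov's dyadic model,
for EVERY `C > 0` and force `g₁ > 0`, on the SIGNED phase space (paper proof in the card / NOTES:
`∇V_J·RHS = cλ^{-1/3}g₁ − cνΣλ^{(4/3)n}xₙ + cλ^{2/3}[½Σ_{n<J}(xₙ−xₙ₊₁)² + ½x₁² − ½x_J² − x_Jx_{J+1}]`,
`xₙ = λ^{n/3}uₙ`; numerics `toy/dyadic_floor_check.py`). The bounded-`C¹`-profile form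
`DyadicKolmogorovFloorSigned` follows by saturating `V_J` outside the energy ball. -/
def DyadicLinearLadderFloor (lam : ℝ) : Prop :=
  ∀ g₁ C : ℝ, 0 < g₁ → 0 < C → ∃ (ε₀ ν₀ c : ℝ), 0 < ε₀ ∧ 0 < ν₀ ∧ 0 < c ∧
    ∀ ν : ℝ, 0 < ν → ν < ν₀ → ∃ J : ℕ, 1 ≤ J ∧ lam ^ J ≤ C * ν ^ (-(3 / 4 : ℝ)) ∧
      ∀ u : ℕ → ℝ, u 0 = 0 → Summable (fun n => lam ^ (2 * n) * u n ^ 2) →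
        let g : ℕ → ℝ := fun n => if n = 1 then g₁ else 0
        ε₀ ≤ ν * (∑' n, lam ^ (2 * n) * u n ^ 2) +
          ∑ n ∈ Finset.Icc 1 J, c * lam ^ (-(n : ℝ) / 3) *
            Literature.Barriers.NavierStokesRegularity.Dyadic.cheskidovRHS lam ν 1 g u n

end Summit.AnomalousDissipation.AnomalousDissipation.Cruxes.KolmogorovFloor.Ideate1
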